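import Literature.AlgebraicGeometry.Resolution.ArithmeticalThreefoldsLocalDescentInertiaStable
import HarnessLib

/-!
# The inertia layer of [CoP1] Prop. 9.3 reduced to the inertia field: climb `K′ → Mⁱ`, then descend from a stable model of `Mⁱ`

Topic: `Literature/AlgebraicGeometry/Resolution`. PROOF side of `CossartPiltant2019ReductionP`
(`ArithmeticalThreefoldsLocal.lean`), input (C4), inertia layer of [CoP1] Prop. 9.3.
`cossartPiltant2019ReductionP_of_cjs_of_stableLayers`
(`ArithmeticalThreefoldsLocalDescentInertiaStable.lean`) asked, for EVERY intermediate field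
`Mˢ ≤ K′ ≤ Mⁱ` with `(LU K′)`, for a `Gˢ`-stable model. Since `(LU K′)` climbs to `(LU Mⁱ)`
along henselian elements ([CoP1] Cor. 6.3; `exists_model_of_henselRoot_of_cofinal` with the
rebasing identities `lift_fixedField_decompositionGroupIn_extendScalars_eq`,
`lift_fixedField_inertiaGroupIn_extendScalars_eq` — "`(LU v₀ⁱ)` holds by proposition 4.9 (1)
as in [CoP1] corollary 7.3"), the unprinted input of the inertia layer can be stated for the
inertia field ALONE: every local uniformization of `Mⁱ` admits a `Gˢ`-stable one on which `Gˢ`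
acts with trivial inertia modulo `Gⁱ` — equivariant local uniformization for the Galois
extension `Mⁱ | Mˢ` of valued fields with group `Gˢ/Gⁱ` acting faithfully on the residue field.

* `inertLayer_descent_of_stableInertiaField` — PROVED: `hInert` (`(LU K′) ⇒ (LU Mˢ)` for
  `Mˢ ≤ K′ ≤ Mⁱ`) from cofinality ([CoP1] Cor. 4.6) and `hStabI` (a `Gˢ`-stable local
  uniformization of the inertia field with trivial inertia modulo kernel, given `(LU Mⁱ)`);
* `cossartPiltant2019ReductionP_of_cjs_of_stableInertiaField` — PROVED:
  `CossartPiltant2019Local → CossartPiltant2019Principalization → CossartJannsenSaito2020General →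
  (embedded resolution of surfaces) → (hStabLoc) → (hStabI) → (hDec) →
  CossartPiltant2019ReductionP`.

Everything is PROVED; no named facts, definitions, instances or notation are introduced.

## Sources

* V. Cossart, O. Piltant, J. Algebra 320 (2008) 1051–1082: Prop. 9.3 and its proof (HAL
  hal-00139124, pp. 26–28), Cor. 4.6, Cor. 6.3. [CossartPiltant2008]
* V. Cossart, O. Piltant, J. Algebra 529 (2019) 268–535 = arXiv:1412.0868, proof of Prop. 4.10
  (arXiv v1: Prop. 4.8, p. 54). [CossartPiltant2019]
-/

noncomputable section

open CategoryTheory AlgebraicGeometry TopologicalSpace IsLocalRing _root_.Polynomial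
  _root_.IntermediateField

namespace Literature.AlgebraicGeometry.Resolution

universe u

section InertiaClimb

variable {S E : Type u} [CommRing S] [Field E] [Algebra S E]

/-- **The inertia layer from a stable model of the inertia field.** Frame: `S` Noetherian in
an ambient valued field `(E, O_E)`; `(LU X)` for a subfield `X ∋ S` means a model
`S[t] ⊆ O_E`, `t ⊆ X ⊆ Frac(S)(t)`, regular at the centre. Hypotheses: cofinality at every
subfield `∋ S` (`hCOF`, [CoP1] Cor. 4.6) and `hStabI`: for `N | M` finite Galois inside `E`,
`(LU Mⁱ)` yields a finite `t ⊆ N` stable under `Gˢ` with `Mˢ ⊆ Frac S[t]`, `S[t] ⊆ O_E`,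
`(S[t])_𝔪` regular, every `τ ∈ Gˢ` fixing `t` pointwise or moving some element of `(S[t])_𝔪`
by a `v`-unit. Claim: `(LU K′) ⇒ (LU Mˢ)` for `Mˢ ≤ K′ ≤ Mⁱ`. Proof: climb `K′ → Z′ → T′`
(decomposition and inertia fields of the valuation over `K′`, [CoP1] Cor. 6.3 twice), where
`T′ = N^{G_T ∩ Gal(N|K′)} = Mⁱ` since `G_T ≤ Gal(N|K′)`; then `hStabI` and
`exists_model_decompositionField_of_stableModel`.
[cite: CossartPiltant2008, proof of Prop. 9.3 (HAL p. 27) and Cor. 6.3] -/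
theorem inertLayer_descent_of_stableInertiaField [IsNoetherianRing S] (OE : ValuationSubring E)
    (hCOF : ∀ (M : Subfield E), (∀ s : S, algebraMap S E s ∈ M) →
      ∀ (t : Finset E), (t : Set E) ⊆ M →
        M ≤ Subfield.closure (Set.range (algebraMap S E) ∪ (t : Set E)) →
      ∀ (hTO : (Algebra.adjoin S (t : Set E)).toSubring ≤ OE.toSubring),
        IsRegularLocalRing (Localization.AtPrime
          (Ideal.comap (Subring.inclusion hTO) (maximalIdeal OE))) →
      ∀ (c : Finset E), (c : Set E) ⊆ M → (∀ x ∈ c, x ∈ OE) →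
      ∃ t' : Finset E, (t' : Set E) ⊆ M ∧
        M ≤ Subfield.closure (Set.range (algebraMap S E) ∪ (t' : Set E)) ∧
        ∃ hTO' : (Algebra.adjoin S (t' : Set E)).toSubring ≤ OE.toSubring,
          IsRegularLocalRing (Localization.AtPrime
            (Ideal.comap (Subring.inclusion hTO') (maximalIdeal OE))) ∧
          ∀ x ∈ c, ∃ a s : E, a ∈ Algebra.adjoin S (t' : Set E) ∧
            s ∈ Algebra.adjoin S (t' : Set E) ∧ OE.valuation s = 1 ∧ x * s = a)
    (hStabI : ∀ (M : Subfield E), (∀ s : S, algebraMap S E s ∈ M) →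
      ∀ (N : IntermediateField M E) [FiniteDimensional M N] [IsGalois M N],
        (∃ t : Finset E, (t : Set E) ⊆ (lift (fixedField (inertiaGroupIn OE N))).toSubfield ∧
          (lift (fixedField (inertiaGroupIn OE N))).toSubfield ≤
            Subfield.closure (Set.range (algebraMap S E) ∪ (t : Set E)) ∧
          ∃ hTO : (Algebra.adjoin S (t : Set E)).toSubring ≤ OE.toSubring,
            IsRegularLocalRing (Localization.AtPrime
              (Ideal.comap (Subring.inclusion hTO) (maximalIdeal OE)))) →
        ∃ t : Finset E, (t : Set E) ⊆ N.toSubfield ∧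
          (lift (fixedField (decompositionGroupIn OE N))).toSubfield ≤
            Subfield.closure (Set.range (algebraMap S E) ∪ (t : Set E)) ∧
          ∃ hTO : (Algebra.adjoin S (t : Set E)).toSubring ≤ OE.toSubring,
            IsRegularLocalRing (Localization.AtPrime
              (Ideal.comap (Subring.inclusion hTO) (maximalIdeal OE))) ∧
            (∀ τ ∈ decompositionGroupIn OE N, ∀ x : N, (x : E) ∈ t → ((τ x : N) : E) ∈ t) ∧
            (∀ τ ∈ decompositionGroupIn OE N, (∀ x : N, (x : E) ∈ t → τ x = x) ∨
              ∃ x : N, (x : E) ∈ locAtCentre (Algebra.adjoin S (t : Set E)).toSubring OE ∧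
                OE.valuation (((τ x : N) : E) - x) = 1))
    (M : Subfield E) (hSM : ∀ s : S, algebraMap S E s ∈ M)
    (N : IntermediateField M E) [FiniteDimensional M N] [IsGalois M N] (K' : Subfield E)
    (hsK' : (lift (fixedField (decompositionGroupIn OE N))).toSubfield ≤ K')
    (hK'i : K' ≤ (lift (fixedField (inertiaGroupIn OE N))).toSubfield)
    (hLUK' : ∃ t : Finset E, (t : Set E) ⊆ K' ∧
      K' ≤ Subfield.closure (Set.range (algebraMap S E) ∪ (t : Set E)) ∧
      ∃ hTO : (Algebra.adjoin S (t : Set E)).toSubring ≤ OE.toSubring,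
        IsRegularLocalRing (Localization.AtPrime
          (Ideal.comap (Subring.inclusion hTO) (maximalIdeal OE)))) :
    ∃ t : Finset E, (t : Set E) ⊆ (lift (fixedField (decompositionGroupIn OE N))).toSubfield ∧
      (lift (fixedField (decompositionGroupIn OE N))).toSubfield ≤
        Subfield.closure (Set.range (algebraMap S E) ∪ (t : Set E)) ∧
      ∃ hTO : (Algebra.adjoin S (t : Set E)).toSubring ≤ OE.toSubring,
        IsRegularLocalRing (Localization.AtPrime
          (Ideal.comap (Subring.inclusion hTO) (maximalIdeal OE))) := by
  classical
  have hMK' : M ≤ K' := (le_lift_toSubfield _).trans hsK'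
  have hK'N : K' ≤ N.toSubfield := hK'i.trans (lift_toSubfield_le _)
  obtain ⟨L', hL', -⟩ := exists_intermediateField_lift_toSubfield_eq N K' hMK' hK'N
  subst hL'
  haveI := finiteDimensional_extendScalars_lift L'
  haveI := isGalois_extendScalars_lift L'
  have hSK' : ∀ s : S, algebraMap S E s ∈ (lift L').toSubfield := fun s => hMK' (hSM s)
  /- Step 1 (Cor. 6.3): `(LU K′) ⇒ (LU Z′)`, `Z′` the decomposition field of the valuation over `K′` -/
  obtain ⟨η, hηV, -, ⟨F, hFmon, hFcoeff, hFη, hF'⟩, hZeq⟩ :=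
    exists_henselRoot_toSubfield_decompositionField_eq OE
      (Subfield.extendScalars (lift_toSubfield_le L'))
  have hLUZ := exists_model_of_henselRoot_of_cofinal OE (lift L').toSubfield
    (hCOF (lift L').toSubfield hSK') hLUK' η hηV F hFmon hFcoeff hFη hF'
  rw [← hZeq] at hLUZ
  /- Step 2 (Cor. 6.3 again): `(LU Z′) ⇒ (LU T′)`, `T′` the inertia field over `K′` -/
  have hSZ : ∀ s : S, algebraMap S E s ∈
      (lift (fixedField (decompositionGroupIn OE
        (Subfield.extendScalars (lift_toSubfield_le L'))))).toSubfield :=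
    fun s => le_lift_toSubfield _ (hSK' s)
  obtain ⟨η', hη'V, -, ⟨F', hF'mon, hF'coeff, hF'η, hF''⟩, hTeq⟩ :=
    exists_henselRoot_toSubfield_inertiaField_eq OE
      (Subfield.extendScalars (lift_toSubfield_le L'))
  have hLUT := exists_model_of_henselRoot_of_cofinal OE _ (hCOF _ hSZ) hLUZ η' hη'V F' hF'mon
    hF'coeff hF'η hF''
  rw [← hTeq, lift_fixedField_inertiaGroupIn_extendScalars_eq N OE L'] at hLUT
  /- `T′ = Mⁱ` since `G_T ≤ Gal(N|K′)` -/
  have hGi : inertiaGroupIn OE N ≤ L'.fixingSubgroup := by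
    have hL'le : L' ≤ fixedField (inertiaGroupIn OE N) := by
      intro x hx
      have h1 : (x : E) ∈ (lift L').toSubfield := (IntermediateField.mem_lift x).mpr hx
      exact (IntermediateField.mem_lift x).mp (hK'i h1)
    exact (IntermediateField.le_iff_le _ _).mp hL'le
  have hinf : inertiaGroupIn OE N ⊓ L'.fixingSubgroup = inertiaGroupIn OE N := inf_eq_left.mpr hGi
  rw [hinf] at hLUT
  /- Step 3: the stable model of `Mⁱ` descends to `Mˢ` -/
  obtain ⟨t, htN, hscl, hTO, hreg, hstab, hI⟩ := hStabI M hSM N hLUT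
  exact exists_model_decompositionField_of_stableModel OE M hSM N t htN hscl hTO hreg hstab hI

/-- **Cossart–Piltant 2019, Prop. 4.10 from Thm. 1.5, principalization, resolution of excellent
surfaces (embedded and non-embedded), "S is stable by G" (tame layer), an equivariant local
uniformization of the INERTIA FIELD (inertia layer), and the decomposition layer of [CoP1]
Prop. 9.3**: `cossartPiltant2019ReductionP_of_cjs_of_layers` with `hInert` discharged by
`inertLayer_descent_of_stableInertiaField` (cofinality from principalization,
`cofinality_of_principalization`). The unprinted input of the inertia layer is now `hStabI`:
given `(LU Mⁱ)` for a finite Galois `N | M` in the frame, a `Gˢ`-stable local uniformization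
(`t ⊆ N`, `Mˢ ⊆ Frac S[t]`) on which every `τ ∈ Gˢ` acts trivially or moves some element of the
local ring by a `v`-unit. [cite: CossartPiltant2019, Props. 4.3, 4.4 and proof of Prop. 4.10 (arXiv v1: Props. 4.2, 4.3, 4.8, pp. 50–54)]
[cite: CossartPiltant2008, Lemma 9.4, Prop. 9.3, Prop. 9.5 (HAL pp. 26–30)]
[cite: CossartJannsenSaito2020, Thm. 1.2, Cor. 1.5] -/
theorem cossartPiltant2019ReductionP_of_cjs_of_stableInertiaField
    (hloc : CossartPiltant2019Local.{u}) (h44 : CossartPiltant2019Principalization.{u})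
    (hCJS : CossartJannsenSaito2020General.{u})
    (hEmb : ∀ (Z : Scheme.{u}) [IsIntegral Z] [IsNoetherian Z], Scheme.IsRegular Z →
      Scheme.IsExcellent Z → ∀ (X : Set Z), IsClosed X → X ≠ Set.univ → topologicalKrullDim X ≤ 2 →
        ∃ (Z' : Scheme.{u}) (π : Z' ⟶ Z), IsProper π ∧ Function.Surjective π.base ∧
          (∃ U : Z.Opens, (U : Set Z) = Xᶜ ∧ IsIso (π ∣_ U)) ∧
          IsStrictNormalCrossingsDivisor Z' (π.base ⁻¹' X))
    (hStabLoc :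
      ∀ (p : ℕ), p.Prime →
      ∀ (S : Type u) [CommRing S] [IsDomain S] [IsRegularLocalRing S],
        IsExcellentRing S → ringKrullDim S = 3 → CharP (ResidueField S) p →
        IsAdicComplete (maximalIdeal S) S →
      ∀ (E : Type u) [Field E] [Algebra S E], Function.Injective (algebraMap S E) →
        IsAlgClosed E → Algebra.IsAlgebraic S E →
      ∀ (OE : ValuationSubring E), (∀ s : S, algebraMap S E s ∈ OE) →
        (∀ s ∈ maximalIdeal S, OE.valuation (algebraMap S E s) < 1) →
        (∀ y : OE, ∃ q : S[X], (∃ i, q.coeff i ∉ maximalIdeal S) ∧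
          OE.valuation (q.eval₂ (algebraMap S E) y) < 1) →
      Nonempty OE.valuation.RankOne →
      ∀ (ℓ : ℕ), ℓ.Prime → ℓ ≠ p → ∀ (ζ : E), IsPrimitiveRoot ζ ℓ →
      ∀ (A : Subfield E), (∀ s : S, algebraMap S E s ∈ A) → ζ ∈ A →
      ∀ (θ : E), θ ∉ A → θ ^ ℓ ∈ A → OE.valuation θ ≤ 1 →
        Module.finrank A (adjoin A ({θ} : Set E)) = ℓ → IsGalois A (adjoin A ({θ} : Set E)) →
        inertiaGroupIn OE (adjoin A ({θ} : Set E)) = ⊤ →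
        (∃ t : Finset E, (t : Set E) ⊆ (adjoin A ({θ} : Set E)).toSubfield ∧
          (adjoin A ({θ} : Set E)).toSubfield ≤
            Subfield.closure (Set.range (algebraMap S E) ∪ (t : Set E)) ∧
          ∃ hTO : (Algebra.adjoin S (t : Set E)).toSubring ≤ OE.toSubring,
            IsRegularLocalRing (Localization.AtPrime
              (Ideal.comap (Subring.inclusion hTO) (maximalIdeal OE)))) →
        (∃ t : Finset E, (t : Set E) ⊆ (adjoin A ({θ} : Set E)).toSubfield ∧
          (adjoin A ({θ} : Set E)).toSubfield ≤
            Subfield.closure (Set.range (algebraMap S E) ∪ (t : Set E)) ∧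
          ∃ hTO : (Algebra.adjoin S (t : Set E)).toSubring ≤ OE.toSubring,
            IsRegularLocalRing (Localization.AtPrime
              (Ideal.comap (Subring.inclusion hTO) (maximalIdeal OE))) ∧
            ∀ (τ : adjoin A ({θ} : Set E) ≃ₐ[A] adjoin A ({θ} : Set E))
              (x : adjoin A ({θ} : Set E)),
              (x : E) ∈ locAtCentre (Algebra.adjoin S (t : Set E)).toSubring OE →
              ((τ x : adjoin A ({θ} : Set E)) : E) ∈
                locAtCentre (Algebra.adjoin S (t : Set E)).toSubring OE))
    (hStabI :
      ∀ (p : ℕ), p.Prime →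
      ∀ (S : Type u) [CommRing S] [IsDomain S] [IsRegularLocalRing S],
        IsExcellentRing S → ringKrullDim S = 3 → CharP (ResidueField S) p →
        IsAdicComplete (maximalIdeal S) S →
      ∀ (E : Type u) [Field E] [Algebra S E], Function.Injective (algebraMap S E) →
        IsAlgClosed E → Algebra.IsAlgebraic S E →
      ∀ (OE : ValuationSubring E), (∀ s : S, algebraMap S E s ∈ OE) →
        (∀ s ∈ maximalIdeal S, OE.valuation (algebraMap S E s) < 1) →
        (∀ y : OE, ∃ q : S[X], (∃ i, q.coeff i ∉ maximalIdeal S) ∧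
          OE.valuation (q.eval₂ (algebraMap S E) y) < 1) →
      Nonempty OE.valuation.RankOne →
      ∀ (M : Subfield E), (∀ s : S, algebraMap S E s ∈ M) →
      ∀ (N : IntermediateField M E) [FiniteDimensional M N] [IsGalois M N],
        (∃ t : Finset E, (t : Set E) ⊆ (lift (fixedField (inertiaGroupIn OE N))).toSubfield ∧
          (lift (fixedField (inertiaGroupIn OE N))).toSubfield ≤
            Subfield.closure (Set.range (algebraMap S E) ∪ (t : Set E)) ∧
          ∃ hTO : (Algebra.adjoin S (t : Set E)).toSubring ≤ OE.toSubring,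
            IsRegularLocalRing (Localization.AtPrime
              (Ideal.comap (Subring.inclusion hTO) (maximalIdeal OE)))) →
        ∃ t : Finset E, (t : Set E) ⊆ N.toSubfield ∧
          (lift (fixedField (decompositionGroupIn OE N))).toSubfield ≤
            Subfield.closure (Set.range (algebraMap S E) ∪ (t : Set E)) ∧
          ∃ hTO : (Algebra.adjoin S (t : Set E)).toSubring ≤ OE.toSubring,
            IsRegularLocalRing (Localization.AtPrime
              (Ideal.comap (Subring.inclusion hTO) (maximalIdeal OE))) ∧
            (∀ τ ∈ decompositionGroupIn OE N, ∀ x : N, (x : E) ∈ t → ((τ x : N) : E) ∈ t) ∧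
            (∀ τ ∈ decompositionGroupIn OE N, (∀ x : N, (x : E) ∈ t → τ x = x) ∨
              ∃ x : N, (x : E) ∈ locAtCentre (Algebra.adjoin S (t : Set E)).toSubring OE ∧
                OE.valuation (((τ x : N) : E) - x) = 1))
    (hDec :
      ∀ (p : ℕ), p.Prime →
      ∀ (S : Type u) [CommRing S] [IsDomain S] [IsRegularLocalRing S],
        IsExcellentRing S → ringKrullDim S = 3 → CharP (ResidueField S) p →
        IsAdicComplete (maximalIdeal S) S →
      ∀ (E : Type u) [Field E] [Algebra S E], Function.Injective (algebraMap S E) →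
        IsAlgClosed E → Algebra.IsAlgebraic S E →
      ∀ (OE : ValuationSubring E), (∀ s : S, algebraMap S E s ∈ OE) →
        (∀ s ∈ maximalIdeal S, OE.valuation (algebraMap S E s) < 1) →
        (∀ y : OE, ∃ q : S[X], (∃ i, q.coeff i ∉ maximalIdeal S) ∧
          OE.valuation (q.eval₂ (algebraMap S E) y) < 1) →
      Nonempty OE.valuation.RankOne →
      ∀ (M : Subfield E), (∀ s : S, algebraMap S E s ∈ M) →
      ∀ (N : IntermediateField M E) [FiniteDimensional M N] [IsGalois M N] (K' : Subfield E),
        M ≤ K' → K' ≤ (lift (fixedField (decompositionGroupIn OE N))).toSubfield →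
        (∃ t : Finset E, (t : Set E) ⊆ K' ∧
          K' ≤ Subfield.closure (Set.range (algebraMap S E) ∪ (t : Set E)) ∧
          ∃ hTO : (Algebra.adjoin S (t : Set E)).toSubring ≤ OE.toSubring,
            IsRegularLocalRing (Localization.AtPrime
              (Ideal.comap (Subring.inclusion hTO) (maximalIdeal OE)))) →
        (∃ t : Finset E, (t : Set E) ⊆ M ∧
          M ≤ Subfield.closure (Set.range (algebraMap S E) ∪ (t : Set E)) ∧
          ∃ hTO : (Algebra.adjoin S (t : Set E)).toSubring ≤ OE.toSubring,
            IsRegularLocalRing (Localization.AtPrime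
              (Ideal.comap (Subring.inclusion hTO) (maximalIdeal OE))))) :
    CossartPiltant2019ReductionP.{u} :=
  cossartPiltant2019ReductionP_of_cjs_of_layers hloc h44 hCJS hEmb hStabLoc
    (fun p hp S _ _ _ hS hSdim hSchar hScomp E _ _ hinj hE halg OE hSO hdom hres hrk M hSM N _ _ K'
        hsK' hK'i hLUK' => by
      haveI := hE
      haveI := halg
      exact inertLayer_descent_of_stableInertiaField OE
        (cofinality_of_principalization h44 p hp S hS hSdim hSchar hScomp E hinj hE halg OE hSO hdom
          hres)
        (fun M' hSM' N' _ _ => hStabI p hp S hS hSdim hSchar hScomp E hinj hE halg OE hSO hdom hres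
          hrk M' hSM' N')
        M hSM N K' hsK' hK'i hLUK')
    hDec

end InertiaClimb

end Literature.AlgebraicGeometry.Resolution

end
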